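import Summits.Ventures.HSemireg.GeneralStructureWiringBloch
import Summits.HodgeConjecture.HodgeConjecture.Theorems.WeilTypeLadderVariationalLocal
import Summits.HodgeConjecture.HodgeConjecture.Theorems.WeilTypeLadderBlochSeed
import HarnessLib

/-!
# HSemireg venture · general structure (G4) — the WIRING, cycle form, ∃ over FAMILIES: ONE Bloch-semiregular cycle per Hodge class ⟹ `HC_AV`
# (Bloch's 1972 reduction in kernel form; the statement the engines' Bloch-`π` certificates witness)

HONEST FRAMING (speculative tier of cell `pub-hsemireg`, team «general structure», seat G4; verbatim the cell's wording rule):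
**nothing here says `HC_AV` or `HC_CM` is proved; every implication carries its named hypotheses.** No `sorry`, no new axiom; axioms
`propext`, `Classical.choice`, `Quot.sound`. `HC_AV` = `Theses.PadicSemiregularLift.HodgeAbelianVarieties` (stmt-1333); `HC_CM` =
`Theses.RankFourFaces.CMAbelianHodge` (stmt-3052) does NOT occur on the main row of this file (see the honest column).

Companion of `GeneralStructureWiringFamilies.lean` ((F2) sheaf form) for the CYCLE door — the map the cell's engines compute for cycles is
Bloch's `π`, whose injectivity is the tree's `IsBlochSemiregular`, and whose transfer theorem is the refereed class-level named fact
`BlochSemiregularSpread m p` (Bloch 1972 Thm. (7.4)/(7.5) = Buchweitz–Flenner Thm. 5.2 at `I = {p}`):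

* `BlochPresentedFamilies` (§1; OURS, SPECULATIVE, OPEN): for every complex abelian variety `A` and every rational `(p,p)` class `c` on `A`
  there EXIST a smooth projective family `f : 𝒳 ⟶ S` of relative dimension `dim A` (`𝒳`, `S` quasi-projective, `S` smooth irreducible), a
  chart `e : A.X ≅ 𝒳_{s₁}`, a global class `W` fibrewise rational `(p,p)` with `e^*(W|_{𝒳_{s₁}}) = c`, a point `s₀`, and a global class `H`
  rational and ALGEBRAIC on every fibre, such that `(W - H)|_{𝒳_{s₀}}` vanishes or is supported on ONE integral Bloch-semiregular local complete
  intersection `Z ↪ 𝒳_{s₀}` of codimension `p` (seed shape `[Z] = q·hᵖ + w`: `H` = the `q·hᵖ` part). ONE WITNESS FAMILY + ONE CYCLE PER HODGE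
  CLASS — what a coverage-table row (component, CM point, representative, `π` injective) witnesses for the classes of that component.
* BF-1 `hc_av_of_blochSpread_of_blochPresentedFamilies` — **`(∀ m p, BlochSemiregularSpread m p) ∧ BlochPresentedFamilies ⟹ HC_AV`**: Bloch's
  theorem at `s₀` gives an open set of fibres on which `W - H` is algebraic (or `W - H` vanishes near `s₀`, flatness), Baire + Hilbert schemes on
  the irreducible base (`WeilTypeLadder.mem_algebraicClasses_of_isOpen_subset_algebraicityLocus`) give every fibre, `W = (W - H) + H`, pull back
  along `e`. NO `HC_CM`, NO Deligne, NO CM point, NO Catanese (the witness carries the fibrewise Hodge clause itself).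
* HONEST COLUMN (revised 2026-08-22 after RED-GS GS-13, kernel: `blochPresentedFamilies_iff_hc_av`, `GeneralStructureWiringConverses.lean`):
  `BlochPresentedFamilies ↔ HC_AV` (granted Bloch 7.4 for `→`; `←` by the constant family over `Spec ℂ`, `W := c`, `H := c`, first disjunct).
  So row BF-1 is an IN-TREE REDUCTION STEP that is a RESTATEMENT of `HC_AV` at the level of the row: «HC_AV modulo {Bloch 7.4, BlochPresentedFamilies}»
  has zero reduction content; Bloch 1972 p. 51 states the VARIATIONAL conjecture/reduction only, and its content lives in the per-family INSTANCES
  (one Bloch-`π` certificate at one point of ONE family ⟹ the class is algebraic on every fibre of THAT family = Bloch 7.4 + Charles–Schnell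
  11.3.11 — the BF-1 proof specialised). `HC_CM` is DOMINATED (`hc_cm_of_blochSpread_of_blochPresentedFamilies`). The ∀-over-CM-fibres cycle form
  `UniformBlochLiftAtCM` (companion) is the `HC_CM`-load-bearing typing, itself sandwiched between `CMToAbelian` and `HC_AV` (RED-GS GS-14).
* BF-2 `↔ HodgeWeilType`; BF-3 position.

## References (bib keys)

Bloch1972Semiregularity (Introduction p. 51; Thm. 7.4, Remark 7.5), BuchweitzFlenner2003 (Thm. 5.2, (8.1), Prop. 8.2), VoisinTorino1994
(Voisin, Lecture 3 «Noether–Lefschetz loci», Thm. 2.3–2.4, pp. 154–155), CharlesSchnell2014Notes (Prop. 11.3.11 (proof)), Fulton1998 (§19.1 purity), VoisinHodgeII2003 (§3.1.2),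
Deligne1982HodgeCycles (§4 Lemma 4.5, Remark 4.10).
-/

noncomputable section

open CategoryTheory
open Literature.AlgebraicGeometry Literature.AlgebraicGeometry.Motives
open Literature.AlgebraicGeometry.HodgeTheory

namespace Summit.Ventures.HSemireg.GeneralStructure

open Summit.HodgeConjecture.HodgeConjecture
open Summit.HodgeConjecture.HodgeConjecture.Ring2.Hypotheses (hc_av_iff_hc_cm_and_cmToAbelian)
open Summit.HodgeConjecture.HodgeConjecture.Ring2Transport (HodgeWeilType pathIn hodgeAbelianVarieties_iff_hodgeWeilType)

/-- `QProj[X]` — `X` quasi-projective over `ℂ` (inlined body of `HodgeTheory.IsQuasiProjectiveOver X`). Local notation only. -/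
local notation3 (prettyPrint := false) "QProj[" X "]" =>
  ∃ (P : SchemeOver ℂ) (j : X ⟶ P), IsProjectiveOver P ∧ AlgebraicGeometry.IsOpenImmersion j.left

/-! ### §1 The hypothesis: one Bloch-semiregular cycle per Hodge class, in a family through the variety -/

/-- **`BlochPresentedFamilies` — ONE WITNESS FAMILY AND ONE BLOCH-SEMIREGULAR CYCLE PER HODGE CLASS** (the «general structure» hypothesis of
cell `pub-hsemireg`, team G, cycle form, ∃ over families; OURS, SPECULATIVE, OPEN — NOT a Literature fact). For every complex abelian variety `A`
and every rational `(p,p)` class `c` on `A`: a smooth projective family `f : 𝒳 ⟶ S` of relative dimension `dim A` (`𝒳`, `S` quasi-projective, `S`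
smooth irreducible), a chart `e : A.X ≅ 𝒳_{s₁}`, a global class `W` rational `(p,p)` on EVERY fibre with `e^*(W|_{𝒳_{s₁}}) = c`, a point `s₀`
and a global class `H` rational and algebraic on every fibre, such that `(W - H)|_{𝒳_{s₀}} = 0` or `(W - H)|_{𝒳_{s₀}}` is SUPPORTED on an
integral local complete intersection `i : Z ↪ 𝒳_{s₀}` of codimension `p` (`IsRegularImmersionOfCodim`, points of coheight `≥ p`) which is
Bloch-semiregular (`IsBlochSemiregular i (dim A) p`) — i.e. by purity `(W - H)|_{𝒳_{s₀}} = μ·cl(Z)`; verbatim the hypotheses of the tree fact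
`BlochSemiregularSpread (dim A) p` at the anchor `𝒳_{s₀}` (chart `Iso.refl`). CLOSEST PRINT (cycle GIVEN): Bloch 1972 Thm. (7.4) with Remark
(7.5) («there exist integers `a, b`, `a ≠ 0`, such that `a z₀ + b l₀ᵖ` is the class of a subscheme `Z₀ ⊂ X₀` which is semi-regular and a local
complete intersection»). HONEST LABEL (revised 2026-08-22, RED-GS GS-13, kernel: `blochPresentedFamilies_iff_hc_av`): EQUIVALENT to `HC_AV` — the free correction
`H` and the first disjunct let `H := c` serve on the constant family as soon as `c` is algebraic; the statement is therefore exactly as open as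
`HC_AV`, and its useful content is per instance (one certificate for one family), not as a row. On-path: `HC_AV → BlochPresentedFamilies`.
NOT asserted. [cite: Bloch1972Semiregularity, Introduction p. 51, Thm. (7.4) and Remark (7.5)]
[cite: BuchweitzFlenner2003, Thm. 5.2, (8.1) and Prop. 8.2] [cite: VoisinTorino1994, Lecture 3 (Noether–Lefschetz loci), Thm. 2.3–2.4, pp. 154–155] [status: open] -/
@[conjecture] def BlochPresentedFamilies : Prop :=
  ∀ (A : AbelianVariety ℂ) (p : ℕ) (c : HodgeTheory.complexBetti A.X (2 * p)),
    HodgeTheory.IsRationalClass c → HodgeTheory.IsOfHodgeType A.dim A.X (2 * p) p p c →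
    ∃ (𝒳 S : SchemeOver ℂ) (f : 𝒳 ⟶ S) (s₁ : ComplexPoints S) (e : A.X ≅ fiberOver f s₁)
      (W : HodgeTheory.complexBetti 𝒳 (2 * p)),
      IsSmoothProjectiveFamily f A.dim ∧ QProj[𝒳] ∧ QProj[S] ∧ IrreducibleSpace S.left ∧ AlgebraicGeometry.Smooth S.hom ∧
      (∀ s : ComplexPoints S, HodgeTheory.IsRationalClass (HodgeTheory.complexBetti.map (fiberι f s) (2 * p) W) ∧
        HodgeTheory.IsOfHodgeType A.dim (fiberOver f s) (2 * p) p p (HodgeTheory.complexBetti.map (fiberι f s) (2 * p) W)) ∧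
      HodgeTheory.complexBetti.map e.hom (2 * p) (HodgeTheory.complexBetti.map (fiberι f s₁) (2 * p) W) = c ∧
      ∃ (s₀ : ComplexPoints S) (H : HodgeTheory.complexBetti 𝒳 (2 * p)),
        (∀ t : ComplexPoints S, IsRationalClass (complexBetti.map (fiberι f t) (2 * p) H) ∧
          complexBetti.map (fiberι f t) (2 * p) H ∈ algebraicClasses (fiberOver f t) p) ∧
        (complexBetti.map (fiberι f s₀) (2 * p) (W - H) = 0 ∨
          ∃ (Z : AlgebraicGeometry.Scheme.{0}) (i : Z ⟶ (fiberOver f s₀).left),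
            AlgebraicGeometry.IsClosedImmersion i ∧ IsRegularImmersionOfCodim i p ∧
            AlgebraicGeometry.IsIntegral Z ∧ (∀ z ∈ Set.range i.base, (p : ℕ∞) ≤ Order.coheight z) ∧
            IsBlochSemiregular i A.dim p ∧
            complexBetti.map (fiberι f s₀) (2 * p) (W - H) ∈ classesSupportedOn (fiberOver f s₀) (Set.range i.base) (2 * p))

/-! ### §2 Row BF-1: Bloch's reduction, cycle form, kernel-checked -/

/-- **BF-1 — `(∀ m p, BlochSemiregularSpread m p) ∧ BlochPresentedFamilies ⟹ HC_AV`** (kernel-checked; literature input = Bloch 1972 Thm. 7.4 /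
BF Thm. 5.2, refereed named fact; NO `HC_CM`, NO Deligne, NO CM point, NO Catanese). Given `(A, c)`: take the witness family; `W - H` is
fibrewise rational `(p,p)` (algebraic ⟹ `(p,p)`, `isOfHodgeType_of_mem_algebraicClasses_of_isSmoothProjective`); in the degenerate case the flat
class `W - H` vanishes on the path component of `s₀` (`transportFun_map_fiberι`), otherwise Bloch's theorem at the anchor `𝒳_{s₀}` (chart
`Iso.refl`) gives an open `U ∋ s₀` of fibres on which `W - H` is algebraic; either way a non-empty open set of fibres with `W = (W - H) + H`
algebraic; Baire + Hilbert schemes on the irreducible base (`WeilTypeLadder.mem_algebraicClasses_of_isOpen_subset_algebraicityLocus`) give every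
fibre, and `c = e^*(W|_{𝒳_{s₁}})`. GRADE (RED-GS GS-13): in-tree reduction step (kernel-checked); as a ROW it is a restatement — the hypothesis
`↔ HC_AV` (`blochPresentedFamilies_iff_hc_av`). [cite: Bloch1972Semiregularity, Thm. (7.4) and Remark (7.5)] [cite: BuchweitzFlenner2003, Thm. 5.2]
[cite: CharlesSchnell2014Notes, Prop. 11.3.11 (proof)] [cite: VoisinHodgeII2003, §3.1.2] -/
theorem hc_av_of_blochSpread_of_blochPresentedFamilies (hB : ∀ m p : ℕ, BlochSemiregularSpread m p)
    (hF : BlochPresentedFamilies) : Theses.PadicSemiregularLift.HodgeAbelianVarieties := by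
  intro A
  refine ⟨nonempty_hodgeModel_holds AbelianVariety.isSmoothProjective_holds, fun p c hc hh ↦ ?_⟩
  obtain ⟨𝒳, S, f, s₁, e, W, hf, h𝒳, hS, hirr, hsm, hW, hWc, s₀, H, hH, hcase⟩ := hF A p c hc hh
  have hq𝒳 : IsQuasiProjectiveOver 𝒳 := h𝒳
  have hqS : IsQuasiProjectiveOver S := hS
  -- `W - H` is rational `(p,p)` on every fibre
  have hWfib : ∀ s : ComplexPoints S,
      IsRationalClass (complexBetti.map (fiberι f s) (2 * p) (W - H)) ∧
        IsOfHodgeType A.dim (fiberOver f s) (2 * p) p p (complexBetti.map (fiberι f s) (2 * p) (W - H)) := by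
    intro s
    have hX : IsSmoothProjective A.dim (fiberOver f s) := hf.isSmoothProjective s
    rw [map_sub]
    refine ⟨?_, (hW s).2.sub hX (isOfHodgeType_of_mem_algebraicClasses_of_isSmoothProjective hX p (hH s).2)⟩
    have hr := (hW s).1.add ((hH s).1.smul (-1 : ℚ))
    rwa [Rat.cast_neg, Rat.cast_one, neg_one_smul, ← sub_eq_add_neg] at hr
  have hsplit : ∀ t : ComplexPoints S, complexBetti.map (fiberι f t) (2 * p) W =
      complexBetti.map (fiberι f t) (2 * p) (W - H) + complexBetti.map (fiberι f t) (2 * p) H := by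
    intro t
    rw [map_sub, sub_add_cancel]
  -- an open set of fibres on which `W - H` is algebraic
  have hgerm : ∃ U : Set (ComplexPoints S), IsOpen U ∧ s₀ ∈ U ∧ ∀ t ∈ U,
      complexBetti.map (fiberι f t) (2 * p) (W - H) ∈ algebraicClasses (fiberOver f t) p := by
    rcases hcase with h0 | ⟨Z, i, hci, hreg, hint, hcoh, hsr, hsupp⟩
    · have hU : IsCohomologicallyLocallyTrivialOn f (Set.univ : Set (ComplexPoints S)) :=
        isCohomologicallyLocallyTrivialOn_univ_of_isQuasiProjectiveOver f hf hqS hsm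
      haveI := hsm
      haveI : LocallyPathConnectedSpace (ComplexPoints S) := locallyPathConnectedSpace_complexPoints_of_smooth S
      refine ⟨pathComponentIn Set.univ s₀, isOpen_univ.pathComponentIn s₀,
        mem_pathComponentIn_self (Set.mem_univ _), fun t ht ↦ ?_⟩
      have hJ : JoinedIn Set.univ s₀ t := ht
      set γ₀ : Path s₀ t := hJ.somePath
      have hγ : ∀ ρ, γ₀ ρ ∈ (Set.univ : Set (ComplexPoints S)) := fun _ ↦ Set.mem_univ _
      have hGt : complexBetti.map (fiberι f t) (2 * p) (W - H) =
          transportFun f (2 * p) hU ⟦pathIn γ₀ Set.univ hγ⟧ (complexBetti.map (fiberι f s₀) (2 * p) (W - H)) :=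
        (transportFun_map_fiberι f (2 * p) hU ⟦pathIn γ₀ Set.univ hγ⟧ (W - H)).symm
      rw [hGt, h0, ← transportLinear_apply, map_zero]
      exact Submodule.zero_mem _
    · have he₀ : complexBetti.map (Iso.refl (fiberOver f s₀)).hom (2 * p) (complexBetti.map (fiberι f s₀) (2 * p) (W - H)) =
          complexBetti.map (fiberι f s₀) (2 * p) (W - H) := by
        rw [Iso.refl_hom, complexBetti.map_id]
        rfl
      obtain ⟨U, hUo, hs₀U, hU⟩ := hB A.dim p (fiberOver f s₀) Z i (complexBetti.map (fiberι f s₀) (2 * p) (W - H)) 𝒳 S f s₀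
        (Iso.refl _) (W - H) hci hreg hint hcoh hsr hsupp hf hq𝒳 hqS hsm hWfib he₀
      exact ⟨U, hUo, hs₀U, hU⟩
  obtain ⟨U, hUo, hs₀U, hUalg⟩ := hgerm
  -- germ ⟹ every fibre, for `W = (W - H) + H`
  haveI := hirr
  have hall := WeilTypeLadder.mem_algebraicClasses_of_isOpen_subset_algebraicityLocus f hq𝒳 hqS hsm hf W hUo ⟨s₀, hs₀U⟩
    (fun t ht ↦ by rw [hsplit t]; exact Submodule.add_mem _ (hUalg t ht) (hH t).2)
  rw [← hWc]
  exact (mem_algebraicClasses_map_iff_of_iso e).2 (hall s₁)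

/-- **BF-2 — `↔ HodgeWeilType`** (ring 2's exactness): the cycle-presented families give the Hodge conjecture for every abelian variety of
Weil type, which IS `HC_AV`. [cite: Deligne1982HodgeCycles, §4 Lemma 4.5 and Remark 4.10] [cite: Bloch1972Semiregularity, Thm. (7.4)] -/
theorem hodgeWeilType_of_blochSpread_of_blochPresentedFamilies (hB : ∀ m p : ℕ, BlochSemiregularSpread m p)
    (hF : BlochPresentedFamilies) : HodgeWeilType :=
  hodgeAbelianVarieties_iff_hodgeWeilType.1 (hc_av_of_blochSpread_of_blochPresentedFamilies hB hF)

/-- **HONEST COLUMN: `HC_CM` is DOMINATED on this row** — Bloch 7.4 ∧ `BlochPresentedFamilies` already give `HC_CM` (a case of `HC_AV`,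
`Ring2.Deform.HC_CM_of_HC_AV`). [cite: Bloch1972Semiregularity, Introduction p. 51] -/
theorem hc_cm_of_blochSpread_of_blochPresentedFamilies (hB : ∀ m p : ℕ, BlochSemiregularSpread m p)
    (hF : BlochPresentedFamilies) : Theses.RankFourFaces.CMAbelianHodge :=
  Ring2.Deform.HC_CM_of_HC_AV (hc_av_of_blochSpread_of_blochPresentedFamilies hB hF)

/-- **BF-3 — POSITION** (conjunction of tree theorems): Bloch 7.4 ∧ the cycle-presented families ⟹ `HC_AV`; `HC_AV ↔ HC_CM ∧ CMToAbelian`;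
`HC_AV ↔ HodgeWeilType`; and the summit gives Bloch's fact back (`blochSemiregularSpread_of_hodgeConjecture`, on-path lemma of the input).
[cite: Bloch1972Semiregularity, Thm. (7.4)] [cite: Deligne1982HodgeCycles, §4] -/
theorem blochFamilies_position :
    ((∀ m p : ℕ, BlochSemiregularSpread m p) → BlochPresentedFamilies → Theses.PadicSemiregularLift.HodgeAbelianVarieties) ∧
    (Theses.PadicSemiregularLift.HodgeAbelianVarieties ↔
      Theses.RankFourFaces.CMAbelianHodge ∧ Theses.RankFourFaces.CMToAbelian) ∧
    (Theses.PadicSemiregularLift.HodgeAbelianVarieties ↔ HodgeWeilType) ∧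
    (_root_.HodgeConjecture → ∀ m p : ℕ, BlochSemiregularSpread m p) :=
  ⟨hc_av_of_blochSpread_of_blochPresentedFamilies, hc_av_iff_hc_cm_and_cmToAbelian, hodgeAbelianVarieties_iff_hodgeWeilType,
    fun h m p ↦ WeilTypeLadder.blochSemiregularSpread_of_hodgeConjecture h m p⟩

/-! ## Audit: nothing is decided here

Every theorem above whose conclusion is `HC_AV`, `HodgeWeilType` or `HC_CM` has among its hypotheses the team's OPEN, SPECULATIVE
`BlochPresentedFamilies` and the refereed named fact `BlochSemiregularSpread` (all `m, p`); the position row is a conjunction of tree theorems.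
Axiom closures: the three standard axioms only. -/

#print axioms Summit.Ventures.HSemireg.GeneralStructure.hc_av_of_blochSpread_of_blochPresentedFamilies

end Summit.Ventures.HSemireg.GeneralStructure

end
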